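import Literature.Analysis.FluidPDE.KNSSMildDecayHorizontal
import HarnessLib

/-!
# Large-scale smallness of caloric extensions and Oseen slices under a Morrey bound at the origin

Analysis/FluidPDE support file (everything proved; no definitions, no named facts).

A field `f` on `ℝ³` obeying the scale-invariant Morrey bound of Albritton–Barker's quantity `A`,
`∫_{B_r(0)} ‖f‖² ≤ I r` for all large `r` (Albritton–Barker 2019, §1: `A(Q(z,r)) ≤ 𝐈` for every
parabolic ball of `ℝ³ × ℝ₋`, read on almost every time slice), is "small on average at large
scales". This file quantifies the two consequences used to kill the parasitic drift of a bounded
weak solution with `𝐈 < ∞` (the mildness step of the forward direction of Albritton–Barker 2019,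
Thm. 1.1, after Koch–Nadirashvili–Seregin–Šverák 2009, proof of Thm. 6.1):

* `norm_heatExtension_origin_le_of_morrey` — the caloric extension at the origin decays,
  `‖e^{ρΔ}f(0)‖ ≤ K J/√ρ` whenever `∫_{B_r(0)} ‖f‖ ≤ J r²` for `r ≥ √ρ` (the `L¹`-Morrey bound that
  Cauchy–Schwarz extracts from the `L²` one, `setLIntegral_enorm_le_of_sq_le`);
* `exists_norm_oseenSlice_origin_le_of_morrey` — the Oseen slice `N_τ[a, a](0) = ∫ K(τ, −y)[a, a] dy`
  (`oseenSlice`, the integrand of the Duhamel term `B(u,u)`, KNSS 2009 §4 (4.3)) obeys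
  `‖N_τ[a, a](0)‖ ≤ K I √ρ/ρ²` for every clock `τ ≥ ρ` whenever `∫_{B_r(0)} ‖a‖² ≤ I r` for
  `r ≥ √ρ`.

Both rest on one dyadic computation (`lintegral_mul_le_of_dyadic_morrey`,
`lintegral_parabolicWeight_mul_le_of_morrey`): against the parabolic weight `(ρ + ‖y‖²)^{-2}` a
density of Morrey mass `≤ J rⁿ` (`n ≤ 3`) on the balls `B_r(0)`, `r ≥ √ρ`, integrates to at most
`2^{n+2} J (√ρ)ⁿ/ρ²` (inner ball `B_{√ρ}` plus the shells `√ρ 2^k ≤ ‖y‖ < √ρ 2^{k+1}`, a geometric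
series); the Gauss–Weierstrass kernel is dominated by the parabolic weight
(`heatKernel_le_mul_parabolicWeight`, from `1 + q + q²/2 ≤ e^q`), and the Oseen kernel by
`C₀ (τ + ‖z‖²)^{-2} ‖a‖ ‖b‖` (KNSS 2009, (3.8); `exists_norm_oseenKernel_three_le`).

## References

* D. Albritton, T. Barker, *On local Type I singularities of the Navier–Stokes equations and
  Liouville theorems*, J. Math. Fluid Mech. 21 (2019) = arXiv:1811.00502, §1, §3. [AlbrittonBarker2019]
* G. Koch, N. Nadirashvili, G. Seregin, V. Šverák, *Liouville theorems for the Navier–Stokes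
  equations and applications*, Acta Math. 203 (2009) = arXiv:0709.3599, §3 (3.8), §4 (4.3), proof
  of Thm. 6.1 (p. 12). [KochNadirashviliSereginSverak2009]
-/

noncomputable section

open MeasureTheory Set Function Filter Metric
open _root_.Topology
open scoped NNReal ENNReal

namespace Literature.Analysis.FluidPDE

/-! ### The dyadic computation -/

section Dyadic

variable {E : Type*} [NormedAddCommGroup E] [MeasurableSpace E] [OpensMeasurableSpace E]
  {μ : Measure E}

/-- **Dyadic bound for a radially dominated weight against a Morrey density.** If
`w(y) ≤ ω(‖y‖)` with `ω` finite and antitone on `[0, ∞)`, and `∫_{B_r(0)} g ≤ G(r)` for all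
`r ≥ a` (`a > 0`), then `∫ w g ≤ ω(0) G(a) + Σ_k ω(a 2^k) G(a 2^{k+1})`: split space into the ball
`B_a(0)` and the shells `a 2^k ≤ ‖y‖ < a 2^{k+1}`. [folklore] -/
theorem lintegral_mul_le_of_dyadic_morrey {w g : E → ℝ≥0∞} {ω G : ℝ → ℝ≥0∞} {a : ℝ} (ha : 0 < a)
    (hω : AntitoneOn ω (Ici 0)) (hωtop : ∀ r, ω r ≠ ∞) (hw : ∀ y, w y ≤ ω ‖y‖)
    (hG : ∀ r, a ≤ r → ∫⁻ y in ball (0 : E) r, g y ∂μ ≤ G r) :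
    ∫⁻ y, w y * g y ∂μ ≤ ω 0 * G a + ∑' k : ℕ, ω (a * 2 ^ k) * G (a * 2 ^ (k + 1)) := by
  set r : ℕ → ℝ := fun k => a * 2 ^ k with hr
  have hr0 : ∀ k, 0 < r k := fun k => by positivity
  have hra : ∀ k, a ≤ r k := fun k =>
    le_mul_of_one_le_right ha.le (one_le_pow₀ (by norm_num : (1 : ℝ) ≤ 2))
  -- the dyadic shells around the origin
  set A : ℕ → Set E := fun k => {y | r k ≤ ‖y‖ ∧ ‖y‖ < r (k + 1)} with hA
  have hcover : (univ : Set E) ⊆ ball (0 : E) a ∪ ⋃ k, A k := by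
    intro y _
    by_cases hy : ‖y‖ < a
    · exact Or.inl (mem_ball_zero_iff.2 hy)
    · push Not at hy
      have hy1 : 1 ≤ ‖y‖ / a := by rw [le_div_iff₀ ha, one_mul]; exact hy
      obtain ⟨n, hn1, hn2⟩ := exists_nat_pow_near hy1 one_lt_two
      refine Or.inr (mem_iUnion.2 ⟨n, ?_, ?_⟩)
      · show a * 2 ^ n ≤ ‖y‖
        rw [mul_comm, ← le_div_iff₀ ha]; exact hn1
      · show ‖y‖ < a * 2 ^ (n + 1)
        rw [mul_comm, ← div_lt_iff₀ ha]; exact hn2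
  have hAball : ∀ k, A k ⊆ ball (0 : E) (r (k + 1)) := fun k y hy => by
    rw [mem_ball_zero_iff]; exact hy.2
  -- the inner ball
  have hball : ∫⁻ y in ball (0 : E) a, w y * g y ∂μ ≤ ω 0 * G a := by
    calc ∫⁻ y in ball (0 : E) a, w y * g y ∂μ
        ≤ ∫⁻ y in ball (0 : E) a, ω 0 * g y ∂μ :=
          lintegral_mono fun y => mul_le_mul_left
            ((hw y).trans (hω (mem_Ici.2 le_rfl) (mem_Ici.2 (norm_nonneg y)) (norm_nonneg y))) _
      _ = ω 0 * ∫⁻ y in ball (0 : E) a, g y ∂μ := lintegral_const_mul' _ _ (hωtop 0)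
      _ ≤ ω 0 * G a := mul_le_mul_right (hG a le_rfl) _
  -- the shells
  have hshell : ∀ k, ∫⁻ y in A k, w y * g y ∂μ ≤ ω (r k) * G (r (k + 1)) := by
    intro k
    calc ∫⁻ y in A k, w y * g y ∂μ
        ≤ ∫⁻ y in A k, ω (r k) * g y ∂μ := by
          refine setLIntegral_mono_ae' ?_ ?_
          · have hc : Continuous fun y : E => ‖y‖ := continuous_norm
            exact (isClosed_le continuous_const hc).measurableSet.inter
              (isOpen_lt hc continuous_const).measurableSet
          · refine Eventually.of_forall fun y hy => mul_le_mul_left ((hw y).trans ?_) _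
            exact hω (mem_Ici.2 (hr0 k).le) (mem_Ici.2 (norm_nonneg y)) hy.1
      _ = ω (r k) * ∫⁻ y in A k, g y ∂μ := lintegral_const_mul' _ _ (hωtop _)
      _ ≤ ω (r k) * ∫⁻ y in ball (0 : E) (r (k + 1)), g y ∂μ :=
          mul_le_mul_right (lintegral_mono_set (hAball k)) _
      _ ≤ ω (r k) * G (r (k + 1)) := mul_le_mul_right (hG _ (hra (k + 1))) _
  calc ∫⁻ y, w y * g y ∂μ
      = ∫⁻ y in univ, w y * g y ∂μ := by rw [Measure.restrict_univ]
    _ ≤ ∫⁻ y in ball (0 : E) a ∪ ⋃ k, A k, w y * g y ∂μ := lintegral_mono_set hcover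
    _ ≤ (∫⁻ y in ball (0 : E) a, w y * g y ∂μ) + ∫⁻ y in ⋃ k, A k, w y * g y ∂μ :=
        lintegral_union_le _ _ _
    _ ≤ ω 0 * G a + ∑' k, ∫⁻ y in A k, w y * g y ∂μ :=
        add_le_add hball (lintegral_iUnion_le _ _)
    _ ≤ ω 0 * G a + ∑' k, ω (r k) * G (r (k + 1)) :=
        add_le_add le_rfl (ENNReal.tsum_le_tsum hshell)

/-- The parabolic weight `r ↦ (ρ + r²)^{-2}` is antitone on `[0, ∞)` (`ρ > 0`). [folklore] -/
theorem antitoneOn_parabolicWeight {ρ : ℝ} (hρ : 0 < ρ) :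
    AntitoneOn (fun r : ℝ => ENNReal.ofReal ((ρ + r ^ 2) ^ (-(2 : ℝ)))) (Ici 0) := by
  intro r₁ hr₁ r₂ _ h12
  refine ENNReal.ofReal_le_ofReal (Real.rpow_le_rpow_of_nonpos (by positivity) ?_ (by norm_num))
  have h0 : 0 ≤ r₁ := hr₁
  nlinarith

/-- `x^{-2} = (x²)⁻¹` for `x > 0` (real powers). [folklore] -/
theorem rpow_neg_two_eq_inv_sq {x : ℝ} (hx : 0 < x) : x ^ (-(2 : ℝ)) = (x ^ 2)⁻¹ := by
  rw [Real.rpow_neg hx.le, Real.rpow_two]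

/-- **The parabolic weight against a Morrey density.** If `∫_{B_r(0)} g ≤ J rⁿ` for all
`r ≥ √ρ` (`ρ > 0`, `J ≥ 0`, `n ≤ 3`), then `∫ (ρ + ‖y‖²)^{-2} g(y) dy ≤ 2^{n+2} J (√ρ)ⁿ/ρ²`: the
inner ball `B_{√ρ}` costs `ρ^{-2} J (√ρ)ⁿ`, the shell `√ρ 2^k ≤ ‖y‖ < √ρ 2^{k+1}` costs at most
`(ρ + ρ 4^k)^{-2} J (√ρ)ⁿ 2^{n(k+1)} ≤ 2ⁿ J (√ρ)ⁿ ρ^{-2} 2^{-k}`. [folklore] -/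
theorem lintegral_parabolicWeight_mul_le_of_morrey {ρ : ℝ} (hρ : 0 < ρ) {g : E → ℝ≥0∞} {J : ℝ}
    (hJ : 0 ≤ J) {n : ℕ} (hn : n ≤ 3)
    (hG : ∀ r, Real.sqrt ρ ≤ r → ∫⁻ y in ball (0 : E) r, g y ∂μ ≤ ENNReal.ofReal (J * r ^ n)) :
    ∫⁻ y, ENNReal.ofReal ((ρ + ‖y‖ ^ 2) ^ (-(2 : ℝ))) * g y ∂μ ≤
      ENNReal.ofReal (2 ^ (n + 2) * J * Real.sqrt ρ ^ n / ρ ^ 2) := by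
  have hsρ : 0 < Real.sqrt ρ := Real.sqrt_pos.2 hρ
  have hsq : Real.sqrt ρ ^ 2 = ρ := Real.sq_sqrt hρ.le
  set ω : ℝ → ℝ≥0∞ := fun r => ENNReal.ofReal ((ρ + r ^ 2) ^ (-(2 : ℝ))) with hω
  set G : ℝ → ℝ≥0∞ := fun r => ENNReal.ofReal (J * r ^ n) with hGdef
  have hmain := lintegral_mul_le_of_dyadic_morrey (μ := μ) (w := fun y => ω ‖y‖) (g := g) hsρ
    (antitoneOn_parabolicWeight hρ) (fun _ => ENNReal.ofReal_ne_top) (fun _ => le_rfl) hG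
  -- the inner ball
  have h0 : ω 0 * G (Real.sqrt ρ) = ENNReal.ofReal (J * Real.sqrt ρ ^ n / ρ ^ 2) := by
    simp only [hω, hGdef]
    rw [← ENNReal.ofReal_mul (Real.rpow_nonneg (by positivity) _)]
    congr 1
    rw [show ρ + (0 : ℝ) ^ 2 = ρ by ring, rpow_neg_two_eq_inv_sq hρ]
    ring
  -- the `k`-th shell
  have hk : ∀ k : ℕ, ω (Real.sqrt ρ * 2 ^ k) * G (Real.sqrt ρ * 2 ^ (k + 1)) ≤
      ENNReal.ofReal (2 ^ n * J * Real.sqrt ρ ^ n / ρ ^ 2 * (1 / 2) ^ k) := by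
    intro k
    simp only [hω, hGdef]
    rw [← ENNReal.ofReal_mul (Real.rpow_nonneg (by positivity) _)]
    refine ENNReal.ofReal_le_ofReal ?_
    have h4 : (0 : ℝ) < 4 ^ k := by positivity
    have hρ4 : ρ + (Real.sqrt ρ * 2 ^ k) ^ 2 = ρ * (1 + 4 ^ k) := by
      rw [mul_pow, hsq, show ((2 : ℝ) ^ k) ^ 2 = 4 ^ k by
        rw [← pow_mul, mul_comm, pow_mul]; norm_num]; ring
    rw [hρ4, rpow_neg_two_eq_inv_sq (by positivity)]
    -- `2^{n(k+1)} 2^k ≤ 2ⁿ (4^k)² ≤ 2ⁿ (1 + 4^k)²`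
    have hpow : (2 : ℝ) ^ (n * (k + 1)) * 2 ^ k ≤ 2 ^ n * (1 + 4 ^ k) ^ 2 := by
      have h1 : (2 : ℝ) ^ (n * (k + 1)) * 2 ^ k = 2 ^ n * 2 ^ ((n + 1) * k) := by
        rw [← pow_add, ← pow_add]; congr 1; ring
      have h2 : (2 : ℝ) ^ ((n + 1) * k) ≤ 2 ^ (4 * k) :=
        pow_le_pow_right₀ one_le_two (Nat.mul_le_mul_right k (by omega))
      have h3 : (2 : ℝ) ^ (4 * k) = (4 ^ k) ^ 2 := by
        rw [pow_mul, sq, ← mul_pow]; norm_num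
      rw [h1]
      refine mul_le_mul_of_nonneg_left (h2.trans ?_) (by positivity)
      rw [h3]
      nlinarith
    have hx : (Real.sqrt ρ * 2 ^ (k + 1)) ^ n = Real.sqrt ρ ^ n * 2 ^ (n * (k + 1)) := by
      rw [mul_pow, ← pow_mul, mul_comm (k + 1) n]
    rw [hx]
    have h2k : (0 : ℝ) < 2 ^ k := by positivity
    rw [show ((1 : ℝ) / 2) ^ k = (2 ^ k)⁻¹ by rw [one_div, inv_pow]]
    rw [show (ρ * (1 + 4 ^ k)) ^ 2 = ρ ^ 2 * (1 + 4 ^ k) ^ 2 by ring]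
    have hsn : 0 ≤ Real.sqrt ρ ^ n := by positivity
    rw [inv_mul_le_iff₀ (by positivity)]
    calc J * (Real.sqrt ρ ^ n * 2 ^ (n * (k + 1)))
        = J * Real.sqrt ρ ^ n * (2 ^ (n * (k + 1)) * 2 ^ k) * (2 ^ k)⁻¹ := by
          field_simp
      _ ≤ J * Real.sqrt ρ ^ n * (2 ^ n * (1 + 4 ^ k) ^ 2) * (2 ^ k)⁻¹ := by gcongr
      _ = ρ ^ 2 * (1 + 4 ^ k) ^ 2 * (2 ^ n * J * Real.sqrt ρ ^ n / ρ ^ 2 * (2 ^ k)⁻¹) := by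
          field_simp
  -- the shells sum to `2^{n+1} J (√ρ)ⁿ/ρ²`
  have hsum : ∑' k : ℕ, ω (Real.sqrt ρ * 2 ^ k) * G (Real.sqrt ρ * 2 ^ (k + 1)) ≤
      ENNReal.ofReal (2 ^ (n + 1) * J * Real.sqrt ρ ^ n / ρ ^ 2) := by
    calc ∑' k : ℕ, ω (Real.sqrt ρ * 2 ^ k) * G (Real.sqrt ρ * 2 ^ (k + 1))
        ≤ ∑' k : ℕ, ENNReal.ofReal (2 ^ n * J * Real.sqrt ρ ^ n / ρ ^ 2 * (1 / 2) ^ k) :=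
          ENNReal.tsum_le_tsum hk
      _ = ENNReal.ofReal (∑' k : ℕ, 2 ^ n * J * Real.sqrt ρ ^ n / ρ ^ 2 * (1 / 2) ^ k) :=
          (ENNReal.ofReal_tsum_of_nonneg (fun k => by positivity)
            (summable_geometric_two.mul_left _)).symm
      _ = ENNReal.ofReal (2 ^ (n + 1) * J * Real.sqrt ρ ^ n / ρ ^ 2) := by
          rw [tsum_mul_left, tsum_geometric_two, pow_succ]; ring_nf
  calc ∫⁻ y, ENNReal.ofReal ((ρ + ‖y‖ ^ 2) ^ (-(2 : ℝ))) * g y ∂μ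
      ≤ ω 0 * G (Real.sqrt ρ) + ∑' k : ℕ, ω (Real.sqrt ρ * 2 ^ k) * G (Real.sqrt ρ * 2 ^ (k + 1)) :=
        hmain
    _ ≤ ENNReal.ofReal (J * Real.sqrt ρ ^ n / ρ ^ 2) +
          ENNReal.ofReal (2 ^ (n + 1) * J * Real.sqrt ρ ^ n / ρ ^ 2) := by
        rw [h0]; exact add_le_add le_rfl hsum
    _ = ENNReal.ofReal ((1 + 2 ^ (n + 1)) * J * Real.sqrt ρ ^ n / ρ ^ 2) := by
        rw [← ENNReal.ofReal_add (by positivity) (by positivity)]; ring_nf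
    _ ≤ ENNReal.ofReal (2 ^ (n + 2) * J * Real.sqrt ρ ^ n / ρ ^ 2) := by
        refine ENNReal.ofReal_le_ofReal (div_le_div_of_nonneg_right ?_ (by positivity))
        refine mul_le_mul_of_nonneg_right (mul_le_mul_of_nonneg_right ?_ hJ) (by positivity)
        rw [pow_succ 2 (n + 1)]
        have : (1 : ℝ) ≤ 2 ^ (n + 1) := one_le_pow₀ one_le_two
        linarith

end Dyadic

/-! ### The Gauss–Weierstrass kernel is dominated by the parabolic weight -/

section Gaussian

variable {E : Type*} [NormedAddCommGroup E] [InnerProductSpace ℝ E]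

/-- **Gaussian vs. parabolic weight**: `G_ρ(y) ≤ (4πρ)^{-d/2} · 128 ρ² · (ρ + ‖y‖²)^{-2}` for
`ρ > 0` — with `q = ‖y‖²/(4ρ)`, `(1 + 4q)² ≤ 128 e^{q}` by `1 + q + q²/2 ≤ e^{q}`. [folklore] -/
theorem heatKernel_le_mul_parabolicWeight {ρ : ℝ} (hρ : 0 < ρ) (y : E) :
    UnboundedOperators.heatKernel ρ y ≤
      (4 * Real.pi * ρ) ^ (-(Module.finrank ℝ E : ℝ) / 2) * (128 * ρ ^ 2) *
        (ρ + ‖y‖ ^ 2) ^ (-(2 : ℝ)) := by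
  set q : ℝ := ‖y‖ ^ 2 / (4 * ρ) with hq
  have hq0 : 0 ≤ q := by positivity
  have hy : ‖y‖ ^ 2 = 4 * ρ * q := by rw [hq]; field_simp
  have hexp := Real.quadratic_le_exp_of_nonneg hq0
  have hkey : (1 + 4 * q) ^ 2 ≤ 128 * Real.exp q := by nlinarith [sq_nonneg q]
  have hpos : 0 < (1 + 4 * q) ^ 2 := by positivity
  have key : Real.exp (-‖y‖ ^ 2 / (4 * ρ)) ≤ 128 * ρ ^ 2 * (ρ + ‖y‖ ^ 2) ^ (-(2 : ℝ)) := by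
    rw [show -‖y‖ ^ 2 / (4 * ρ) = -q by rw [hq, neg_div], Real.exp_neg, hy,
      show ρ + 4 * ρ * q = ρ * (1 + 4 * q) by ring, rpow_neg_two_eq_inv_sq (by positivity),
      show (ρ * (1 + 4 * q)) ^ 2 = ρ ^ 2 * (1 + 4 * q) ^ 2 by ring, mul_inv,
      show 128 * ρ ^ 2 * ((ρ ^ 2)⁻¹ * ((1 + 4 * q) ^ 2)⁻¹) = 128 * ((1 + 4 * q) ^ 2)⁻¹ by
        field_simp]
    rw [inv_le_iff_one_le_mul₀ (Real.exp_pos q), ← div_eq_mul_inv, div_mul_eq_mul_div,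
      le_div_iff₀ hpos]
    linarith
  calc UnboundedOperators.heatKernel ρ y
      = (4 * Real.pi * ρ) ^ (-(Module.finrank ℝ E : ℝ) / 2) * Real.exp (-‖y‖ ^ 2 / (4 * ρ)) := rfl
    _ ≤ (4 * Real.pi * ρ) ^ (-(Module.finrank ℝ E : ℝ) / 2) *
          (128 * ρ ^ 2 * (ρ + ‖y‖ ^ 2) ^ (-(2 : ℝ))) :=
        mul_le_mul_of_nonneg_left key (by positivity)
    _ = _ := by ring

end Gaussian

/-! ### Consequences on `ℝ³` -/

section Three

/-- Local notation for physical space `ℝ³ = EuclideanSpace ℝ (Fin 3)`. -/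
local notation "ℝ³" => EuclideanSpace ℝ (Fin 3)

variable {F : Type*} [NormedAddCommGroup F] [NormedSpace ℝ F]

omit [NormedSpace ℝ F] in
/-- **Cauchy–Schwarz on a set**: `∫⁻_s ‖f‖ ≤ (μ s)^{1/2} (∫⁻_s ‖f‖²)^{1/2}`. [folklore] -/
theorem setLIntegral_enorm_le_sqrt_mul_sqrt {α : Type*} [MeasurableSpace α] {μ : Measure α}
    {f : α → F} (hf : AEStronglyMeasurable f μ) (s : Set α) :
    ∫⁻ x in s, ‖f x‖ₑ ∂μ ≤ (μ s) ^ (1 / 2 : ℝ) * (∫⁻ x in s, ‖f x‖ₑ ^ 2 ∂μ) ^ (1 / 2 : ℝ) := by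
  have hpq : (2 : ℝ).HolderConjugate 2 := by
    rw [Real.holderConjugate_iff]; norm_num
  have h := ENNReal.lintegral_mul_le_Lp_mul_Lq (μ.restrict s) hpq (f := fun _ => (1 : ℝ≥0∞))
    (g := fun x => ‖f x‖ₑ) aemeasurable_const hf.restrict.enorm
  simp only [Pi.mul_apply, one_mul, ENNReal.one_rpow, lintegral_const, Measure.restrict_apply,
    MeasurableSet.univ, univ_inter] at h
  have e2 : ∀ x, ‖f x‖ₑ ^ (2 : ℝ) = ‖f x‖ₑ ^ (2 : ℕ) := fun x => by
    rw [← ENNReal.rpow_natCast]; norm_num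
  simp_rw [e2] at h
  simpa only [one_mul] using h

omit [NormedSpace ℝ F] in
/-- **From the `L²`-Morrey bound to the `L¹` one on `ℝ³`**: if `∫_{B_r(0)} ‖f‖² ≤ I r` then
`∫_{B_r(0)} ‖f‖ ≤ (V₁ I)^{1/2} r²`, `V₁ = |B₁(0)|` (Cauchy–Schwarz, `|B_r| = V₁ r³`). [folklore] -/
theorem setLIntegral_enorm_ball_le_of_morrey {f : ℝ³ → F} (hf : AEStronglyMeasurable f volume)
    {I r : ℝ} (hI : 0 ≤ I) (hr : 0 < r)
    (h : ∫⁻ y in ball (0 : ℝ³) r, ‖f y‖ₑ ^ 2 ≤ ENNReal.ofReal (I * r)) :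
    ∫⁻ y in ball (0 : ℝ³) r, ‖f y‖ₑ ≤
      ENNReal.ofReal (Real.sqrt ((volume (ball (0 : ℝ³) 1)).toReal * I) * r ^ 2) := by
  set V₁ : ℝ := (volume (ball (0 : ℝ³) 1)).toReal with hV₁
  have hV₁0 : 0 ≤ V₁ := ENNReal.toReal_nonneg
  have hvol : volume (ball (0 : ℝ³) r) = ENNReal.ofReal (V₁ * r ^ 3) := by
    rw [Measure.addHaar_ball_of_pos volume (0 : ℝ³) hr, finrank_euclideanSpace_fin, hV₁,
      mul_comm, ENNReal.ofReal_mul hV₁0, ENNReal.ofReal_toReal measure_ball_lt_top.ne]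
  calc ∫⁻ y in ball (0 : ℝ³) r, ‖f y‖ₑ
      ≤ (volume (ball (0 : ℝ³) r)) ^ (1 / 2 : ℝ) *
          (∫⁻ y in ball (0 : ℝ³) r, ‖f y‖ₑ ^ 2) ^ (1 / 2 : ℝ) :=
        setLIntegral_enorm_le_sqrt_mul_sqrt hf _
    _ ≤ (ENNReal.ofReal (V₁ * r ^ 3)) ^ (1 / 2 : ℝ) * (ENNReal.ofReal (I * r)) ^ (1 / 2 : ℝ) := by
        rw [hvol]; gcongr
    _ = ENNReal.ofReal (Real.sqrt ((volume (ball (0 : ℝ³) 1)).toReal * I) * r ^ 2) := by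
        rw [ENNReal.ofReal_rpow_of_nonneg (by positivity) (by norm_num),
          ENNReal.ofReal_rpow_of_nonneg (by positivity) (by norm_num),
          ← ENNReal.ofReal_mul (by positivity), ← Real.sqrt_eq_rpow, ← Real.sqrt_eq_rpow,
          ← Real.sqrt_mul (by positivity), ← hV₁]
        congr 1
        rw [show V₁ * r ^ 3 * (I * r) = (V₁ * I) * (r ^ 2) ^ 2 by ring,
          Real.sqrt_mul (by positivity), Real.sqrt_sq (by positivity)]

/-- **Large-scale decay of the caloric extension at the origin under an `L¹`-Morrey bound**:
`‖e^{ρΔ}f(0)‖ ≤ 2048 (4π)^{-3/2} J/√ρ` whenever `∫_{B_r(0)} ‖f‖ ≤ J r²` for all `r ≥ √ρ`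
(`G_ρ ≤ (4πρ)^{-3/2} 128 ρ² (ρ + ‖y‖²)^{-2}` and the dyadic bound with `n = 2`). [folklore] -/
theorem norm_heatExtension_origin_le_of_morrey {f : ℝ³ → F} {ρ J : ℝ} (hρ : 0 < ρ) (hJ : 0 ≤ J)
    (hf : ∀ r, Real.sqrt ρ ≤ r → ∫⁻ y in ball (0 : ℝ³) r, ‖f y‖ₑ ≤ ENNReal.ofReal (J * r ^ 2)) :
    ‖UnboundedOperators.heatExtension f ρ 0‖ ≤
      2048 * (4 * Real.pi) ^ (-(3 : ℝ) / 2) * J / Real.sqrt ρ := by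
  set Cρ : ℝ := (4 * Real.pi * ρ) ^ (-(3 : ℝ) / 2) * (128 * ρ ^ 2) with hCρ
  have hCρ0 : 0 ≤ Cρ := by positivity
  have hsρ : 0 < Real.sqrt ρ := Real.sqrt_pos.2 hρ
  -- the pointwise domination of the integrand
  have hpt : ∀ y : ℝ³, ‖UnboundedOperators.heatKernel ρ (0 - y) • f y‖ₑ ≤
      ENNReal.ofReal Cρ * (ENNReal.ofReal ((ρ + ‖y‖ ^ 2) ^ (-(2 : ℝ))) * ‖f y‖ₑ) := by
    intro y
    have hK := heatKernel_le_mul_parabolicWeight (E := ℝ³) hρ (0 - y)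
    rw [finrank_euclideanSpace_fin, zero_sub, norm_neg] at hK
    have hK0 : 0 ≤ UnboundedOperators.heatKernel ρ (-y) := (UnboundedOperators.heatKernel_pos hρ _).le
    rw [zero_sub, enorm_smul, ← mul_assoc, ← ENNReal.ofReal_mul hCρ0, Real.enorm_eq_ofReal hK0]
    exact mul_le_mul_left (ENNReal.ofReal_le_ofReal (by simpa only [Nat.cast_ofNat] using hK)) _
  have hmain : ‖UnboundedOperators.heatExtension f ρ 0‖ₑ ≤
      ENNReal.ofReal (Cρ * (2 ^ (2 + 2) * J * Real.sqrt ρ ^ 2 / ρ ^ 2)) := by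
    rw [UnboundedOperators.heatExtension_eq_integral_sub]
    calc ‖∫ y, UnboundedOperators.heatKernel ρ (0 - y) • f y‖ₑ
        ≤ ∫⁻ y, ‖UnboundedOperators.heatKernel ρ (0 - y) • f y‖ₑ := enorm_integral_le_lintegral_enorm _
      _ ≤ ∫⁻ y, ENNReal.ofReal Cρ * (ENNReal.ofReal ((ρ + ‖y‖ ^ 2) ^ (-(2 : ℝ))) * ‖f y‖ₑ) :=
          lintegral_mono hpt
      _ = ENNReal.ofReal Cρ * ∫⁻ y, ENNReal.ofReal ((ρ + ‖y‖ ^ 2) ^ (-(2 : ℝ))) * ‖f y‖ₑ :=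
          lintegral_const_mul' _ _ ENNReal.ofReal_ne_top
      _ ≤ ENNReal.ofReal Cρ * ENNReal.ofReal (2 ^ (2 + 2) * J * Real.sqrt ρ ^ 2 / ρ ^ 2) :=
          mul_le_mul_right (lintegral_parabolicWeight_mul_le_of_morrey hρ hJ (by norm_num) hf) _
      _ = ENNReal.ofReal (Cρ * (2 ^ (2 + 2) * J * Real.sqrt ρ ^ 2 / ρ ^ 2)) :=
          (ENNReal.ofReal_mul hCρ0).symm
  rw [← ofReal_norm] at hmain
  refine ((ENNReal.ofReal_le_ofReal_iff (by positivity)).1 hmain).trans (le_of_eq ?_)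
  -- bookkeeping of the constant: `Cρ · 16 J ρ/ρ² = 2048 (4π)^{-3/2} J/√ρ`
  rw [hCρ, Real.sq_sqrt hρ.le, Real.mul_rpow (by positivity) hρ.le]
  have h32 : ρ ^ (-(3 : ℝ) / 2) = (ρ * Real.sqrt ρ)⁻¹ := by
    rw [show (-(3 : ℝ) / 2) = -(3 / 2 : ℝ) by ring, Real.rpow_neg hρ.le,
      show (3 / 2 : ℝ) = 1 + 1 / 2 by norm_num, Real.rpow_add hρ, Real.rpow_one,
      Real.sqrt_eq_rpow]
  rw [h32]
  field_simp
  ring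

/-- **Large-scale decay of the Oseen slice at the origin under an `L²`-Morrey bound.** There is an
absolute constant `K > 0` (`8 C₀`, `C₀` the constant of KNSS (3.8)) such that for `0 < ρ ≤ τ` and
every field `a` on `ℝ³` with `∫_{B_r(0)} ‖a‖² ≤ I r` for all `r ≥ √ρ` (`I ≥ 0`),
`‖N_τ[a, a](0)‖ = ‖∫ K(τ, −y)[a(y), a(y)] dy‖ ≤ K I √ρ/ρ²` (the kernel is at most
`C₀ (τ + ‖y‖²)^{-2} ‖a‖² ≤ C₀ (ρ + ‖y‖²)^{-2} ‖a‖²`; dyadic bound with `n = 1`). No measurability is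
needed (`‖∫ f‖ₑ ≤ ∫⁻ ‖f‖ₑ`). [cite: KochNadirashviliSereginSverak2009, §3 (3.8) and §4 (4.3) (arXiv:0709.3599)] -/
theorem exists_norm_oseenSlice_origin_le_of_morrey :
    ∃ K : ℝ, 0 < K ∧ ∀ {a : ℝ³ → ℝ³} {ρ τ I : ℝ}, 0 < ρ → ρ ≤ τ → 0 ≤ I →
      (∀ r, Real.sqrt ρ ≤ r → ∫⁻ y in ball (0 : ℝ³) r, ‖a y‖ₑ ^ 2 ≤ ENNReal.ofReal (I * r)) →
      ‖oseenSlice τ a a 0‖ ≤ K * I * (Real.sqrt ρ / ρ ^ 2) := by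
  obtain ⟨C₀, hC₀, hK⟩ := exists_norm_oseenKernel_three_le
  refine ⟨8 * C₀, by positivity, fun {a ρ τ I} hρ hρτ hI hMor => ?_⟩
  have hτ : 0 < τ := hρ.trans_le hρτ
  -- pointwise domination of the integrand
  have hpt : ∀ y : ℝ³, ‖oseenKernel τ (0 - y) (a y) (a y)‖ₑ ≤
      ENNReal.ofReal C₀ * (ENNReal.ofReal ((ρ + ‖y‖ ^ 2) ^ (-(2 : ℝ))) * ‖a y‖ₑ ^ 2) := by
    intro y
    rw [← ofReal_norm, ← ofReal_norm, ← ENNReal.ofReal_pow (norm_nonneg _), ← mul_assoc,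
      ← ENNReal.ofReal_mul hC₀.le, ← ENNReal.ofReal_mul (by positivity)]
    refine ENNReal.ofReal_le_ofReal ?_
    have h1 : (τ + ‖0 - y‖ ^ 2) ^ (-(2 : ℝ)) ≤ (ρ + ‖y‖ ^ 2) ^ (-(2 : ℝ)) := by
      rw [zero_sub, norm_neg]
      exact Real.rpow_le_rpow_of_nonpos (by positivity) (by linarith) (by norm_num)
    calc ‖oseenKernel τ (0 - y) (a y) (a y)‖
        ≤ C₀ * (τ + ‖0 - y‖ ^ 2) ^ (-(2 : ℝ)) * ‖a y‖ * ‖a y‖ := hK hτ _ _ _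
      _ ≤ C₀ * (ρ + ‖y‖ ^ 2) ^ (-(2 : ℝ)) * ‖a y‖ * ‖a y‖ := by gcongr
      _ = C₀ * (ρ + ‖y‖ ^ 2) ^ (-(2 : ℝ)) * ‖a y‖ ^ 2 := by ring
  have hMor' : ∀ r, Real.sqrt ρ ≤ r → ∫⁻ y in ball (0 : ℝ³) r, ‖a y‖ₑ ^ 2 ≤
      ENNReal.ofReal (I * r ^ 1) := fun r hr => by rw [pow_one]; exact hMor r hr
  have hmain : ‖oseenSlice τ a a 0‖ₑ ≤ ENNReal.ofReal (C₀ * (2 ^ (1 + 2) * I * Real.sqrt ρ ^ 1 / ρ ^ 2)) := by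
    rw [oseenSlice_apply]
    calc ‖∫ y, oseenKernel τ (0 - y) (a y) (a y)‖ₑ
        ≤ ∫⁻ y, ‖oseenKernel τ (0 - y) (a y) (a y)‖ₑ := enorm_integral_le_lintegral_enorm _
      _ ≤ ∫⁻ y, ENNReal.ofReal C₀ * (ENNReal.ofReal ((ρ + ‖y‖ ^ 2) ^ (-(2 : ℝ))) * ‖a y‖ₑ ^ 2) :=
          lintegral_mono hpt
      _ = ENNReal.ofReal C₀ * ∫⁻ y, ENNReal.ofReal ((ρ + ‖y‖ ^ 2) ^ (-(2 : ℝ))) * ‖a y‖ₑ ^ 2 :=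
          lintegral_const_mul' _ _ ENNReal.ofReal_ne_top
      _ ≤ ENNReal.ofReal C₀ * ENNReal.ofReal (2 ^ (1 + 2) * I * Real.sqrt ρ ^ 1 / ρ ^ 2) :=
          mul_le_mul_right (lintegral_parabolicWeight_mul_le_of_morrey hρ hI (by norm_num) hMor') _
      _ = ENNReal.ofReal (C₀ * (2 ^ (1 + 2) * I * Real.sqrt ρ ^ 1 / ρ ^ 2)) :=
          (ENNReal.ofReal_mul hC₀.le).symm
  rw [← ofReal_norm] at hmain
  refine ((ENNReal.ofReal_le_ofReal_iff (by positivity)).1 hmain).trans (le_of_eq ?_)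
  ring

end Three

end Literature.Analysis.FluidPDE

end
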